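import Summits.KontsevichZagierPeriods.KontsevichZagierPeriods.Theorems.HermiteRigidityReductionRigidityEulerDeformation

/-!
# `ReductionRigidity` (stmt-KontsevichZagierPeriods-3407), line `Sketch`, growth line `bloch-suslin-rational-dilog`:
# EULER'S REFLECTION FORMULA as a chain of moves, explicit form

Route `KontsevichZagierPeriods/HermiteRigidity`, crux `ReductionRigidity` (stmt-3407; skeleton
`Cruxes/ReductionRigidity/Lines/Sketch.lean` v7). Registered sub-goal stub `stub_eulerReflectionBox` (lead c6).
For EVERY rational `0 < x < 1` and any representations on the closed square with the printed integrands,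

  `[□², x/(1−xpq)] + [□², (1−x)/(1−(1−x)pq)] + [□², ((x−1)/(1+(x−1)p))·((−x)/(1−xq))] − [□², 2/(1+pq)] ∈ KZ.relations`

(values `Li₂(x) + Li₂(1−x) + log x·log(1−x) − ζ(2) = 0`: Euler 1768), i.e. Euler's reflection formula INSIDE the
Kontsevich–Zagier calculus with `ζ(2)` carried by the regular alternating box `[□², 2/(1+pq)]`. Composition of two
landed chains: the deformation invariance `E(x) ≡ E(1/2)` (`stub_eulerDeformation`, Stokes in the argument) and
Landen's chain at `N = 2` (`stub_boxLanden`: `[□²,2/(2−pq)] − [□²,2/(1+pq)] + [□²,1/((2−p)(2−q))] ∈ relations`), the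
`log·log` carrier of `E(1/2)` being literally `[□², 1/((2−p)(2−q))]` (`log²2`).

References: M. Kontsevich, D. Zagier, *Periods* (2001), §1.2 [cite: KontsevichZagier2001, §1.2]; D. Zagier,
*The dilogarithm function* (2007), Ch. I §2 [cite: Zagier2007Dilogarithm, Ch. I §2]. No definitions are introduced.
-/

noncomputable section

open MeasureTheory Set MvPolynomial

namespace Summit.KontsevichZagierPeriods.HermiteRigidity.ReductionRigidity

open Literature.NumberTheory.Transcendental
open Literature.NumberTheory.Transcendental.KZ

/-- A regular box representation `[□², e/((2 − p)(2 − q))]` and the level-2 symbol `[□², e/(2 − pq)]` exist.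
[cite: KontsevichZagier2001, §1.1] -/
theorem exists_eulerBox_halfReps (e : ℚ) : ∃ r s : IntegralRep 2, r.domain = cube 2 ∧
    EqOn r.integrand (fun p => (e : ℝ) / ((2 - p 0) * (2 - p 1))) (cube 2) ∧ s.domain = cube 2 ∧
    EqOn s.integrand (fun p => (e : ℝ) / (2 - p 0 * p 1)) (cube 2) := by
  have h1 : ∀ x ∈ cube 2, aeval x (((2 - X 0) * (2 - X 1) : MvPolynomial (Fin 2) ℚ)) ≠ 0 := by
    intro x hx
    have h := landen_face_bounds hx
    simp only [map_sub, map_mul, map_ofNat, aeval_X]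
    exact mul_ne_zero (by linarith) (by linarith)
  have h2 : ∀ x ∈ cube 2, aeval x ((2 - X 0 * X 1 : MvPolynomial (Fin 2) ℚ)) ≠ 0 := by
    intro x hx
    have h := landen_face_bounds hx
    simp only [map_sub, map_mul, map_ofNat, aeval_X]
    linarith
  exact ⟨(⟨C e, _, h1⟩ : RFun 2).rep, (⟨C e, _, h2⟩ : RFun 2).rep, rfl, fun x _ => by simp [RFun.fn_apply], rfl,
    fun x _ => by simp [RFun.fn_apply]⟩

/-- **Registered stub `stub_eulerReflectionBox`: Euler's reflection formula as a chain of moves**, explicit form: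
for every rational `0 < x < 1`,
`[□², x/(1−xpq)] + [□², (1−x)/(1−(1−x)pq)] + [□², ((x−1)/(1+(x−1)p))·((−x)/(1−xq))] − [□², 2/(1+pq)] ∈ KZ.relations`.
[cite: Zagier2007Dilogarithm, Ch. I §2] [cite: KontsevichZagier2001, §1.2] -/
theorem stub_eulerReflectionBox : ∀ (x : ℚ), 0 < x → x < 1 → ∀ (r₁ r₂ r₃ s : IntegralRep 2),
    r₁.domain = cube 2 → EqOn r₁.integrand (fun p => (x : ℝ) / (1 - (x : ℝ) * p 0 * p 1)) (cube 2) →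
    r₂.domain = cube 2 →
    EqOn r₂.integrand (fun p => (((1 - x : ℚ)) : ℝ) / (1 - ((1 - x : ℚ) : ℝ) * p 0 * p 1)) (cube 2) →
    r₃.domain = cube 2 →
    EqOn r₃.integrand (fun p => (((x : ℝ) - 1) / (1 + ((x : ℝ) - 1) * p 0)) *
      ((-(x : ℝ)) / (1 - (x : ℝ) * p 1))) (cube 2) →
    s.domain = cube 2 → EqOn s.integrand (fun p => 2 / (1 + p 0 * p 1)) (cube 2) →
    KZ.of r₁ + KZ.of r₂ + KZ.of r₃ - KZ.of s ∈ KZ.relations := by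
  intro x hx hx1 r₁ r₂ r₃ s hr₁ hr₁i hr₂ hr₂i hr₃ hr₃i hs hsi
  -- representations at the anchor `1/2`: the symbol `[1/(2−pq)]`, its double, and `[1/((2−p)(2−q))]`
  obtain ⟨rP, h₁, hrP, hrPi, hh₁, hh₁i⟩ := exists_eulerBox_halfReps 1
  obtain ⟨_u, h₂, _, _, hh₂, hh₂i⟩ := exists_eulerBox_halfReps 2
  -- deformation from `x` to `1/2`
  have hdef := stub_eulerDeformation x (1 / 2) hx hx1 (by norm_num) (by norm_num) r₁ r₂ r₃ h₁ h₁ rP hr₁ hr₁i hr₂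
    hr₂i hr₃ hr₃i hh₁ (fun p hp => by
      have h := landen_face_bounds hp
      have d : (2 : ℝ) - p 0 * p 1 ≠ 0 := by linarith
      have d' : (1 : ℝ) - ((1 / 2 : ℚ) : ℝ) * p 0 * p 1 ≠ 0 := by push_cast; linarith
      rw [hh₁i hp]
      beta_reduce
      rw [div_eq_div_iff d d']
      push_cast
      ring) hh₁ (fun p hp => by
      have h := landen_face_bounds hp
      have d : (2 : ℝ) - p 0 * p 1 ≠ 0 := by linarith
      have d' : (1 : ℝ) - ((1 - 1 / 2 : ℚ) : ℝ) * p 0 * p 1 ≠ 0 := by push_cast; linarith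
      rw [hh₁i hp]
      beta_reduce
      rw [div_eq_div_iff d d']
      push_cast
      ring) hrP (fun p hp => by
      have h := landen_face_bounds hp
      have d1 : (2 : ℝ) - p 0 ≠ 0 := by linarith
      have d2 : (2 : ℝ) - p 1 ≠ 0 := by linarith
      have d3 : (1 : ℝ) + ((1 / 2 : ℚ) - 1 : ℝ) * p 0 ≠ 0 := by push_cast; linarith
      have d4 : (1 : ℝ) - ((1 / 2 : ℚ) : ℝ) * p 1 ≠ 0 := by push_cast; linarith
      rw [hrPi hp]
      beta_reduce
      rw [div_mul_div_comm, div_eq_div_iff (mul_ne_zero d1 d2) (mul_ne_zero d3 d4)]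
      push_cast
      ring)
  -- Landen at `N = 2`: `[2/(2−pq)] − [2/(1+pq)] + [1/((2−p)(2−q))] ∈ relations`
  have hL := stub_boxLanden 2 le_rfl h₂ s rP hh₂ (fun p hp => by rw [hh₂i hp]; push_cast; ring) hs
    (fun p hp => by rw [hsi hp]; push_cast; ring) hrP (fun p hp => by rw [hrPi hp]; push_cast; ring)
  -- `[2/(2−pq)] ≡ [1/(2−pq)] + [1/(2−pq)]`
  have hsplit : KZ.of h₂ - KZ.of h₁ - KZ.of h₁ ∈ KZ.relations :=
    integrandAddRel_subset_relations ⟨2, h₂, h₁, h₁, hh₁.trans hh₂.symm, hh₁.trans hh₂.symm, fun p hp => by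
      rw [hh₂] at hp
      rw [Pi.add_apply, hh₂i hp, hh₁i hp]; push_cast; ring, rfl⟩
  have : KZ.of r₁ + KZ.of r₂ + KZ.of r₃ - KZ.of s =
      ((KZ.of r₁ + KZ.of r₂ + KZ.of r₃) - (KZ.of h₁ + KZ.of h₁ + KZ.of rP)) + (KZ.of h₂ - KZ.of s + KZ.of rP) -
        (KZ.of h₂ - KZ.of h₁ - KZ.of h₁) := by abel
  rw [this]
  exact KZ.relations.sub_mem (KZ.relations.add_mem hdef hL) hsplit

end Summit.KontsevichZagierPeriods.HermiteRigidity.ReductionRigidity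

end
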